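import Summits.ABC.StewartYu.PadicG3ParNB
import Summits.ABC.StewartYu.PadicG3VbSched
import Summits.ABC.StewartYu.PadicG3SchedB
import HarnessLib

/-!
# Cell abc-stewartyu, WP-L.P(odd) (crux r3 `PadicCoreOddRat`, stmt-ABC-20503): the RECORD SCHEDULE of the saturated frame —
# `PadicG3ParN.schedN b : G3Sched n` (p1's N-layer: `L₀ := L0N`, `Ŝ := SdN`, `Mord := MordN`; box scale `LV/b`) and its order / box laws

`Summits/ABC/StewartYu/PadicG3SatNSched.lean` — cell `abc-stewartyu` (HOME `run/shared/lean/pub/abc-stewartyu/`; seat p2-g6, pack twin step 1;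
record owner p1 g10, substitution list of his 16:26Z line / memo ParN-design-g10 §2, ruling R28/R31).  One definition and theorems; no named fact.
Twin of `PadicG3SchedB.schedVb` + `PadicG3VbSched` (p3-g7) with the N-atoms of `PadicG3ParN`:

* `PadicG3ParN.schedN b` — `m := P.m`, `Lbox := LV/b`, `A`, `L₀ := L0N`, `H := HV`, `Sd := SdN`, `Xs := XsV`, `T := TV`, `Mord := MordN`
  (decrement laws from `MordN_sub_succ` / `MordN_level`);
* `RN_mono`, `RN_one_le` (`RN 1 ≤ 8·LgV + ŜN`), `MordN_at_n`;
* the derived schedule quantities: `NS_N`, `NhS_N`, `tS_N`, `TordS_N` (rfl), `TordS_N_le_zero`, `TordS_N_zero_real_le`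
  (`TordS 0 0 ≤ (69/4)(n+1)LgV + 2(n+1)(ŜN − ŜG)`, p1's `MordN_T0_le`), `TordS_N_half_sub_le` (`≤ MV/(n+2)³ + (n+1)(RN 1 + ŜN)`);
* the box is the `Vb` box: `sideS₂_N_eq` (`sideS₂ (schedN b) = sideS₂ (schedVb b)`, rfl) — so `sideS₂_Vb_le`, `Lb_Vb_le`, `sum_Lb_Vb_le` apply verbatim.

WHAT THIS IS NOT: sizes/budgets/lines of the pack (next files); no crux moves.

References: Yu. V. Nesterenko, LNM 1819 (2003) (4.3)–(4.5), §3.5; K. Yu, Acta Math. 211 (2013) §5.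
-/

noncomputable section

open Finset Real
open Literature.NumberTheory.Transcendental

namespace Summit.ABC.StewartYu

namespace PadicG3ParN

variable {n : ℕ} (P : PadicG3ParN n) (b : ℝ)

/-- **The record schedule of the saturated odd-`p` frame** with box scale `LV/b` (p1's N-layer on the v2 family).
[cite: Nesterenko2003, (4.3)–(4.5); shape only] -/
def schedN : G3Sched n where
  m := P.m
  Lbox := (P.LV : ℝ) / b
  A := P.A
  L₀ := P.L0N
  H := P.HV
  Sd := P.SdN
  Xs := P.XsV
  T := P.TV
  Mord := P.MordN
  hA := P.A_pos
  hH := P.one_le_HV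
  kstep_law := fun s ν hν => (P.MordN_sub_succ s ν hν.le).symm.le
  half_law := fun s hs => by rw [← P.MordN_level s hs]; exact (P.MordN_sub_succ s n le_rfl).symm.le

/-- field. [folklore] -/ theorem schedN_Lbox : (P.schedN b).Lbox = (P.LV : ℝ) / b := rfl
/-- field. [folklore] -/ theorem schedN_m : (P.schedN b).m = P.m := rfl
/-- field. [folklore] -/ theorem schedN_A : (P.schedN b).A = P.A := rfl
/-- field. [folklore] -/ theorem schedN_L₀ : (P.schedN b).L₀ = P.L0N := rfl
/-- field. [folklore] -/ theorem schedN_H : (P.schedN b).H = P.HV := rfl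
/-- field. [folklore] -/ theorem schedN_Sd : (P.schedN b).Sd = P.SdN := rfl
/-- field. [folklore] -/ theorem schedN_Xs : (P.schedN b).Xs = P.XsV := rfl
/-- field. [folklore] -/ theorem schedN_T : (P.schedN b).T = P.TV := rfl
/-- field. [folklore] -/ theorem schedN_Mord : (P.schedN b).Mord = P.MordN := rfl

/-! ### The tail sums `RN` and the orders `MordN` -/

/-- `RN` is antitone in the level. [folklore] -/
theorem RN_mono {s s' : ℕ} (h : s ≤ s') : P.RN s' ≤ P.RN s := by
  unfold RN
  exact Finset.sum_le_sum_of_subset (Finset.Icc_subset_Icc h le_rfl)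

/-- `RN 1 ≤ 8 LgV + ŜN` (geometric part `Σ_{s ≥ 1} 8LgV/2^s ≤ 8 LgV`, floor part `≤ ŜN`). [folklore] -/
theorem RN_one_le : P.RN 1 ≤ 8 * P.LgV + P.SdN := by
  unfold RN PadicG3Par.TV
  have h1 : ∀ s ∈ Finset.Icc 1 P.SdN, max 1 (8 * P.LgV / 2 ^ s) ≤ 1 + 8 * P.LgV / 2 ^ s := by
    intro s _; exact max_le (Nat.le_add_right 1 _) (Nat.le_add_left _ _)
  refine (Finset.sum_le_sum h1).trans ?_
  rw [Finset.sum_add_distrib, Finset.sum_const, Nat.card_Icc, smul_eq_mul, mul_one]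
  have h2 : ∑ s ∈ Finset.Icc 1 P.SdN, 8 * P.LgV / 2 ^ s ≤ 8 * P.LgV := by
    have hreal : ((∑ s ∈ Finset.Icc 1 P.SdN, 8 * P.LgV / 2 ^ s : ℕ) : ℝ) ≤ 8 * P.LgV := by
      rw [Nat.cast_sum]
      have hterm : ∀ s ∈ Finset.Icc 1 P.SdN, ((8 * P.LgV / 2 ^ s : ℕ) : ℝ) ≤ (4 * (P.LgV : ℝ)) * (1 / 2) ^ (s - 1) := by
        intro s hs
        rw [Finset.mem_Icc] at hs
        have hs2 : (2 : ℝ) ^ s = 2 * 2 ^ (s - 1) := by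
          rw [← pow_succ']; congr 1; omega
        calc ((8 * P.LgV / 2 ^ s : ℕ) : ℝ) ≤ ((8 * P.LgV : ℕ) : ℝ) / ((2 ^ s : ℕ) : ℝ) := Nat.cast_div_le
          _ = (4 * (P.LgV : ℝ)) * (1 / 2) ^ (s - 1) := by
              push_cast; rw [hs2, one_div, inv_pow]; field_simp; ring
      have hgeo : ∑ s ∈ Finset.Icc 1 P.SdN, (1 / 2 : ℝ) ^ (s - 1) ≤ 2 := by
        rw [← Finset.Ico_succ_right_eq_Icc, Order.succ_eq_add_one, Finset.sum_Ico_eq_sum_range]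
        simp only [Nat.add_sub_cancel_left, Nat.add_sub_cancel]
        exact sum_geometric_two_le _
      calc ∑ s ∈ Finset.Icc 1 P.SdN, ((8 * P.LgV / 2 ^ s : ℕ) : ℝ)
          ≤ ∑ s ∈ Finset.Icc 1 P.SdN, (4 * (P.LgV : ℝ)) * (1 / 2) ^ (s - 1) := Finset.sum_le_sum hterm
        _ = (4 * (P.LgV : ℝ)) * ∑ s ∈ Finset.Icc 1 P.SdN, (1 / 2 : ℝ) ^ (s - 1) := by rw [Finset.mul_sum]
        _ ≤ (4 * (P.LgV : ℝ)) * 2 := mul_le_mul_of_nonneg_left hgeo (by positivity)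
        _ = 8 * P.LgV := by ring
    exact_mod_cast hreal
  omega

/-- `MordN s n = MV/(n+2)³ + (n+1)·RN (s+1) + TV s`. [folklore] -/
theorem MordN_at_n (s : ℕ) : P.MordN s n = P.MV / (n + 2) ^ 3 + (n + 1) * P.RN (s + 1) + P.TV s := by
  unfold MordN
  rw [show n + 1 - n = 1 by omega, one_mul]

end PadicG3ParN

namespace G3Setup

variable {p : ℕ} [Fact p.Prime] (S : G3Setup p) (P : PadicG3ParN S.n) (b : ℝ)

/-! ### The schedule `P.schedN b` through the derived quantities -/

/-- `NS (schedN b) lev ν = 2^ν · XsV lev`. [folklore] -/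
theorem NS_N (lev ν : ℕ) : S.NS (P.schedN b) lev ν = 2 ^ ν * P.XsV lev := rfl

/-- `NhS (schedN b) lev = XsV lev`. [folklore] -/
theorem NhS_N (lev : ℕ) : S.NhS (P.schedN b) lev = P.XsV lev := rfl

/-- `tS (schedN b) lev = TV lev + 1`. [folklore] -/
theorem tS_N (lev : ℕ) : S.tS (P.schedN b) lev = P.TV lev + 1 := rfl

/-- `TordS (schedN b) lev ν = MordN lev ν + (ŜN − lev)(n+1) + (n − ν)`. [folklore] -/
theorem TordS_N (lev ν : ℕ) : S.TordS (P.schedN b) lev ν = P.MordN lev ν + ((P.SdN - lev) * (S.n + 1) + (S.n - ν)) := rfl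

/-- The `N` schedule and the `Vb` schedule agree at level `lev` in their node counts. [folklore] -/
theorem NS_N_eq_Vb (lev ν : ℕ) : S.NS (P.schedN b) lev ν = S.NS (P.toPadicG3Par.schedVb b) lev ν := rfl

/-- `NS (schedN b) lev ν ≤ 2^ν (2^lev g XV/2 + 1)` (real). [folklore] -/
theorem NS_N_real_le (lev ν : ℕ) : (S.NS (P.schedN b) lev ν : ℝ) ≤ 2 ^ ν * (2 ^ lev * P.g * P.XV / 2 + 1) := by
  rw [S.NS_N P b]
  push_cast
  exact mul_le_mul_of_nonneg_left (P.XsV_le lev) (by positivity)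

/-- **`TordS lev ν ≤ TordS 0 0`** along the schedule. [folklore] -/
theorem TordS_N_le_zero (lev ν : ℕ) : S.TordS (P.schedN b) lev ν ≤ S.TordS (P.schedN b) 0 0 := by
  rw [S.TordS_N P b, S.TordS_N P b]
  have h1 := P.MordN_le_zero_zero lev ν
  have h2 : (P.SdN - lev) * (S.n + 1) ≤ (P.SdN - 0) * (S.n + 1) := Nat.mul_le_mul_right _ (Nat.sub_le_sub_left (Nat.zero_le _) _)
  have h3 : S.n - ν ≤ S.n - 0 := Nat.sub_le_sub_left (Nat.zero_le _) _
  omega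

/-- **`TordS 0 0 ≤ (69/4)(n+1)·LgV + 2(n+1)(ŜN − ŜG)`** (real; p1's `MordN_T0_le`). [folklore] -/
theorem TordS_N_zero_real_le (hNq : P.Nq = P.K) :
    (S.TordS (P.schedN b) 0 0 : ℝ) ≤ (69 / 4) * (S.n + 1) * P.LgV + 2 * (S.n + 1) * ((P.SdN : ℝ) - P.SdG) := by
  rw [S.TordS_N P b]
  have h := P.MordN_T0_le hNq
  simp only [Nat.sub_zero]
  push_cast
  nlinarith [h]

/-- **The half-step order budget**: `TordS lev n − tS lev ≤ MV/(n+2)³ + (n+1)(RN 1 + ŜN)`. [folklore] -/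
theorem TordS_N_half_sub_le (lev : ℕ) :
    S.TordS (P.schedN b) lev S.n - S.tS (P.schedN b) lev ≤ P.MV / (S.n + 2) ^ 3 + (S.n + 1) * (P.RN 1 + P.SdN) := by
  rw [S.TordS_N P b, S.tS_N P b, P.MordN_at_n]
  simp only [Nat.sub_self, add_zero]
  have h1 : P.RN (lev + 1) ≤ P.RN 1 := P.RN_mono (by omega)
  have h2 : (P.SdN - lev) * (S.n + 1) ≤ (S.n + 1) * P.SdN := by rw [mul_comm]; exact Nat.mul_le_mul_left _ (Nat.sub_le _ _)
  have h3 : (S.n + 1) * P.RN (lev + 1) ≤ (S.n + 1) * P.RN 1 := Nat.mul_le_mul_left _ h1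
  have e : (S.n + 1) * (P.RN 1 + P.SdN) = (S.n + 1) * P.RN 1 + (S.n + 1) * P.SdN := mul_add _ _ _
  apply tsub_le_iff_right.mpr
  linarith

/-- The half-step order budget, real: `≤ 2·LgV + (n+1)(8·LgV + 2·ŜN)`. [folklore] -/
theorem TordS_N_half_sub_real_le (lev : ℕ) :
    ((S.TordS (P.schedN b) lev S.n - S.tS (P.schedN b) lev : ℕ) : ℝ) ≤ 2 * P.LgV + (S.n + 1) * (8 * P.LgV + 2 * P.SdN) := by
  have h0 : ((S.TordS (P.schedN b) lev S.n - S.tS (P.schedN b) lev : ℕ) : ℝ) ≤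
      ((P.MV / (S.n + 2) ^ 3 + (S.n + 1) * (P.RN 1 + P.SdN) : ℕ) : ℝ) := by exact_mod_cast S.TordS_N_half_sub_le P b lev
  have h1 : ((P.MV / (S.n + 2) ^ 3 : ℕ) : ℝ) ≤ 2 * P.LgV := by exact_mod_cast P.MV_div_le
  have h2 : ((P.RN 1 : ℕ) : ℝ) ≤ 8 * P.LgV + P.SdN := by exact_mod_cast P.RN_one_le
  push_cast at h0 ⊢
  have hn : (0 : ℝ) ≤ S.n := by positivity
  nlinarith [mul_le_mul_of_nonneg_left h2 (by positivity : (0:ℝ) ≤ (S.n:ℝ) + 1)]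

/-! ### The box is the `Vb` box -/

/-- `sideS₂ (schedN b) = sideS₂ (schedVb b)` (same `Lbox`, `A`). [folklore] -/
theorem sideS₂_N_eq (j : Fin S.n) : S.sideS₂ (P.schedN b) j = S.sideS₂ (P.toPadicG3Par.schedVb b) j := rfl

/-- `Lb (sideS₂ (schedN b)) = Lb (sideS₂ (schedVb b))`. [folklore] -/
theorem Lb_sideS₂_N_eq (lev : ℕ) : S.Lb (S.sideS₂ (P.schedN b)) lev = S.Lb (S.sideS₂ (P.toPadicG3Par.schedVb b)) lev := rfl

/-- `sideS₂ (schedN b) j ≤ LV/(2 Aⱼ)` for `b ≥ 1`. [folklore] -/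
theorem sideS₂_N_le (hb : 1 ≤ b) (j : Fin S.n) : (S.sideS₂ (P.schedN b) j : ℝ) ≤ P.LV / (2 * P.A j) := by
  rw [S.sideS₂_N_eq P b]; exact S.sideS₂_Vb_le P.toPadicG3Par b hb j

/-- **`Lb (sideS₂ (schedN b)) lev j ≤ LV/(2^lev Aⱼ)`** for `b ≥ 1`. [folklore] -/
theorem Lb_N_le (hb : 1 ≤ b) (lev : ℕ) (j : Fin S.n) :
    (S.Lb (S.sideS₂ (P.schedN b)) lev j : ℝ) ≤ P.LV / (2 ^ lev * P.A j) := by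
  rw [S.Lb_sideS₂_N_eq P b]; exact S.Lb_Vb_le P.toPadicG3Par b hb lev j

/-- `Σⱼ Lb·Aⱼ ≤ n·LV/2^lev`. [folklore] -/
theorem sum_Lb_mul_A_N_le (hb : 1 ≤ b) (lev : ℕ) :
    ∑ j, (S.Lb (S.sideS₂ (P.schedN b)) lev j : ℝ) * P.A j ≤ S.n * P.LV / 2 ^ lev := by
  rw [S.Lb_sideS₂_N_eq P b]; exact S.sum_Lb_mul_A_Vb_le P.toPadicG3Par b hb lev

/-- `Σⱼ Lb ≤ n·LV/2^lev` when every `Aⱼ ≥ 1`. [folklore] -/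
theorem sum_Lb_N_le (hb : 1 ≤ b) (hA1 : ∀ j, 1 ≤ P.A j) (lev : ℕ) :
    ∑ j, (S.Lb (S.sideS₂ (P.schedN b)) lev j : ℝ) ≤ S.n * P.LV / 2 ^ lev := by
  rw [S.Lb_sideS₂_N_eq P b]; exact S.sum_Lb_Vb_le P.toPadicG3Par b hb hA1 lev

end G3Setup

end Summit.ABC.StewartYu

end
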